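import Summits.AtomisticToContinuum.BoseEinsteinCondensation.Theorems.BECThomsonPrincipleFibreConductanceCageDefs
import Summits.AtomisticToContinuum.BoseEinsteinCondensation.Theorems.InfraredMinimumUncertainty.Negative.FreeMinimisersConstant
import Literature.MathematicalPhysics.QuantumManyBody.PeriodicBoseGasImpurityTranslation
import HarnessLib

/-!
# Route `BECThomsonPrinciple`, crux `FibreConductance` (stmt-AtomisticToContinuum-9480),
# line `tagged-path-harnack-cage-moments`: the free-gas instance of `stub_localNumberTail`

`LocalNumberExpMoments` (the statement `Goal.stub_localNumberTail` of
`BECThomsonPrincipleFibreConductanceCageDefs`) asks, for bounded repulsive finite-range `v`, every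
`Λ ≥ 0` and `R > 0`, for `N`-, `L`-uniform Born exponential moments `E e^{Λ n_R} ≤ C` of the local
particle numbers `n_R` — at a fixed location (`locNumber`) and around the tagged particle
(`tagNumber`) — of every EXACT zero-free minimiser at density `≤ ρ₀`: the quantum `T = 0` canonical
analogue of the Ruelle / Park superstability bound, an open input of the line.

This file is its NON-VACUITY CERTIFICATE: the `v = 0` instance of the statement, verbatim, holds —
for EVERY density bound `ρ₀`, with `N₀ = 0` and the explicit Poisson constant
`C = exp((e^Λ − 1) · (4π/3)R³ · ρ₀)` (`localNumberExpMoments_free`). Proof: every exact minimiser of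
the free periodic energy is a constant `c` (`exists_eq_const_of_free_minimiser`), `|c|² = L^{-3N}`,
so the Born law is the uniform law on `[0,L)^{3N}`; then `e^{Λ n_R(X)} = ∏ⱼ w(xⱼ)` with the one-body
weight `w = e^Λ` on the torus `R`-neighbourhood of the centre and `1` elsewhere, Tonelli factorises
the cell integral (`lintegral_cellN_prod`), and `∫_cell w ≤ L³ + (e^Λ − 1)|B_R|` because the torus
neighbourhood, unfolded over the lattice, has Lebesgue volume at most `|B_R| = (4π/3)R³` for EVERY
`R` and `L` (`lintegral_cell_periodizedPotential_sub` applied to the indicator profile `1_{[0,R)}`):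
`E e^{Λ n_R} ≤ (1 + (e^Λ − 1)|B_R|/L³)^N ≤ exp((e^Λ − 1)|B_R| N/L³)`. For the tagged count the tagged
particle is split off first (`lintegral_cellN_succ_fst`) and the same bound is applied to the `m`
bath particles.

References: D. Ruelle, *Statistical Mechanics: Rigorous Results* (1969) §3.2 (ideal-gas local
number statistics are Poisson/binomial); Y. M. Park, Commun. Math. Phys. 94 (1984) 1.
-/

noncomputable section

namespace Summit.AtomisticToContinuum.BoseEinsteinCondensation.Cruxes.FibreConductance.TaggedPathHarnack

open MeasureTheory
open scoped ENNReal Classical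
open Literature.MathematicalPhysics.QuantumManyBody.BoseGas
open Summit.AtomisticToContinuum.BoseEinsteinCondensation.Theorems.GaussianDominationCan.Negative
  (lintegral_cellN_prod)
open Summit.AtomisticToContinuum.BoseEinsteinCondensation.Theorems.InfraredMinimumUncertainty.Negative
  (exists_eq_const_of_free_minimiser)

variable {m : ℕ} {L : ℝ}

/-! ### Counting through a product of one-body weights -/

/-- `e^{Λ #{j ∈ s : p j}} = ∏_{j ∈ s} (p j ? e^Λ : 1)`. [folklore] -/
theorem exp_mul_card_filter {ι : Type*} (s : Finset ι) (p : ι → Prop) [DecidablePred p] (Λ : ℝ) :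
    Real.exp (Λ * ((s.filter p).card : ℝ)) = ∏ j ∈ s, if p j then Real.exp Λ else 1 := by
  rw [Finset.natCast_card_filter, Finset.mul_sum, Real.exp_sum]
  refine Finset.prod_congr rfl fun j _ => ?_
  split_ifs <;> simp

/-- The torus-proximity relation is open in both arguments (a union of open conditions over the
lattice). [folklore] -/
theorem isOpen_setOf_torusNear {α : Type*} [TopologicalSpace α] {a b : α → Space}
    (ha : Continuous a) (hb : Continuous b) (L R : ℝ) : IsOpen {z | TorusNear L R (a z) (b z)} := by
  have h : {z | TorusNear L R (a z) (b z)} = ⋃ n : Fin 3 → ℤ, {z | ‖a z - b z - latticeVec L n‖ < R} := by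
    ext z; simp [TorusNear]
  rw [h]
  exact isOpen_iUnion fun n => isOpen_lt (by fun_prop) continuous_const

/-- The one-body Boltzmann weight of the counting observable — `e^Λ` within torus distance `R` of the
centre `x`, `1` elsewhere — is measurable. [folklore] -/
theorem measurable_nearWeight (L R Λ : ℝ) (x : Space) :
    Measurable fun y : Space => ENNReal.ofReal (if TorusNear L R x y then Real.exp Λ else 1) :=
  (Measurable.ite (isOpen_setOf_torusNear continuous_const continuous_id L R).measurableSet
    measurable_const measurable_const).ennreal_ofReal

/-- `e^{Λ #{j : |X_j − x|_T < R}} = ∏ⱼ w(X_j)` in `ℝ≥0∞`. [folklore] -/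
theorem ofReal_exp_mul_card_eq_prod {N : ℕ} (L R Λ : ℝ) (x : Space) (X : Config N) :
    ENNReal.ofReal (Real.exp (Λ *
        ((Finset.univ.filter fun j : Fin N => TorusNear L R x (X j)).card : ℝ))) =
      ∏ j, ENNReal.ofReal (if TorusNear L R x (X j) then Real.exp Λ else 1) := by
  rw [exp_mul_card_filter, ENNReal.ofReal_prod_of_nonneg]
  intro j _
  split_ifs <;> positivity

/-! ### The torus neighbourhood has volume at most `|B_R|` -/

/-- The indicator profile `1_{[0,R)}` (whose periodisation `1^per(x − y) = #{n : |x − y − Ln| < R}`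
counts lattice images) is measurable. [folklore] -/
theorem measurable_nearProfile (R : ℝ) :
    Measurable (Set.indicator (Set.Iio R) fun _ : ℝ => (1 : ℝ≥0∞)) :=
  measurable_const.indicator measurableSet_Iio

/-- Torus proximity is witnessed by one lattice image, so it is dominated by the periodised
indicator: `1{|x − y|_T < R} ≤ 1^per_{[0,R)}(y − x)`. [folklore] -/
theorem one_le_periodizedPotential_of_torusNear {L R : ℝ} {x y : Space} (h : TorusNear L R x y) :
    (1 : ℝ≥0∞) ≤ periodizedPotential (Set.indicator (Set.Iio R) fun _ : ℝ => (1 : ℝ≥0∞)) L (y - x) := by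
  obtain ⟨n, hn⟩ := h
  rw [periodizedPotential_sub_comm]
  unfold periodizedPotential
  calc (1 : ℝ≥0∞) = Set.indicator (Set.Iio R) (fun _ : ℝ => (1 : ℝ≥0∞)) ‖x - y - latticeVec L n‖ := by
        rw [Set.indicator_of_mem (show ‖x - y - latticeVec L n‖ ∈ Set.Iio R from hn)]
    _ ≤ ∑' k : Fin 3 → ℤ, Set.indicator (Set.Iio R) (fun _ : ℝ => (1 : ℝ≥0∞)) ‖x - y - latticeVec L k‖ :=
        ENNReal.le_tsum
          (f := fun k : Fin 3 → ℤ => Set.indicator (Set.Iio R) (fun _ : ℝ => (1 : ℝ≥0∞)) ‖x - y - latticeVec L k‖) n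

/-- `∫_{ℝ³} 1_{[0,R)}(|y|) dy = |B_R| = (4π/3) R³` (`R ≥ 0`). [folklore] -/
theorem lintegral_nearProfile_norm {R : ℝ} (hR : 0 ≤ R) :
    ∫⁻ y : Space, Set.indicator (Set.Iio R) (fun _ : ℝ => (1 : ℝ≥0∞)) ‖y‖ =
      ENNReal.ofReal (4 / 3 * Real.pi * R ^ 3) := by
  have h : (fun y : Space => Set.indicator (Set.Iio R) (fun _ : ℝ => (1 : ℝ≥0∞)) ‖y‖) =
      (Metric.ball (0 : Space) R).indicator 1 := by
    funext y
    by_cases hy : ‖y‖ < R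
    · rw [Set.indicator_of_mem (show ‖y‖ ∈ Set.Iio R from hy),
        Set.indicator_of_mem (mem_ball_zero_iff.2 hy), Pi.one_apply]
    · rw [Set.indicator_of_notMem (show ‖y‖ ∉ Set.Iio R from hy),
        Set.indicator_of_notMem (fun h => hy (mem_ball_zero_iff.1 h))]
  rw [h, lintegral_indicator_one Metric.isOpen_ball.measurableSet,
    EuclideanSpace.volume_ball_fin_three, ← ENNReal.ofReal_pow hR, ← ENNReal.ofReal_mul (by positivity)]
  congr 1
  ring

/-- The one-body weight is dominated by `1 + (e^Λ − 1)·1^per_{[0,R)}(y − x)`. [folklore] -/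
theorem nearWeight_le (L R : ℝ) {Λ : ℝ} (hΛ : 0 ≤ Λ) (x y : Space) :
    ENNReal.ofReal (if TorusNear L R x y then Real.exp Λ else 1) ≤
      1 + ENNReal.ofReal (Real.exp Λ - 1) *
        periodizedPotential (Set.indicator (Set.Iio R) fun _ : ℝ => (1 : ℝ≥0∞)) L (y - x) := by
  have he : 0 ≤ Real.exp Λ - 1 := by linarith [Real.add_one_le_exp Λ]
  split_ifs with h
  · calc ENNReal.ofReal (Real.exp Λ) = 1 + ENNReal.ofReal (Real.exp Λ - 1) := by
          rw [← ENNReal.ofReal_one, ← ENNReal.ofReal_add zero_le_one he]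
          congr 1; ring
      _ ≤ 1 + ENNReal.ofReal (Real.exp Λ - 1) *
            periodizedPotential (Set.indicator (Set.Iio R) fun _ : ℝ => (1 : ℝ≥0∞)) L (y - x) := by
          gcongr
          exact le_mul_of_one_le_right' (one_le_periodizedPotential_of_torusNear h)
  · simp

/-- **The one-body cell integral**: `∫_cell w ≤ L³ + (e^Λ − 1)|B_R|`, for every centre `x ∈ ℝ³`,
every `R > 0` and every side `L > 0` (no relation between `R` and `L` is needed: the torus
`R`-neighbourhood unfolds injectively in measure onto the ball). [folklore] -/
theorem lintegral_cell_nearWeight_le (hL : 0 < L) {Λ R : ℝ} (hΛ : 0 ≤ Λ) (hR : 0 < R) (x : Space) :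
    ∫⁻ y in cell L, ENNReal.ofReal (if TorusNear L R x y then Real.exp Λ else 1) ≤
      ENNReal.ofReal (L ^ 3 + (Real.exp Λ - 1) * (4 / 3 * Real.pi * R ^ 3)) := by
  have he : 0 ≤ Real.exp Λ - 1 := by linarith [Real.add_one_le_exp Λ]
  calc ∫⁻ y in cell L, ENNReal.ofReal (if TorusNear L R x y then Real.exp Λ else 1)
      ≤ ∫⁻ y in cell L, (1 + ENNReal.ofReal (Real.exp Λ - 1) *
          periodizedPotential (Set.indicator (Set.Iio R) fun _ : ℝ => (1 : ℝ≥0∞)) L (y - x)) :=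
        lintegral_mono fun y => nearWeight_le L R hΛ x y
    _ = (∫⁻ _y in cell L, (1 : ℝ≥0∞)) + ENNReal.ofReal (Real.exp Λ - 1) *
          ∫⁻ y in cell L, periodizedPotential (Set.indicator (Set.Iio R) fun _ : ℝ => (1 : ℝ≥0∞)) L (y - x) := by
        rw [lintegral_add_left measurable_const, lintegral_const_mul' _ _ ENNReal.ofReal_ne_top]
    _ = ENNReal.ofReal (L ^ 3) + ENNReal.ofReal (Real.exp Λ - 1) * ENNReal.ofReal (4 / 3 * Real.pi * R ^ 3) := by
        rw [setLIntegral_one, volume_cell, ← ENNReal.ofReal_pow hL.le,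
          lintegral_cell_periodizedPotential_sub hL (measurable_nearProfile R) x,
          lintegral_nearProfile_norm hR.le]
    _ = ENNReal.ofReal (L ^ 3 + (Real.exp Λ - 1) * (4 / 3 * Real.pi * R ^ 3)) := by
        rw [← ENNReal.ofReal_mul he, ← ENNReal.ofReal_add (by positivity) (by positivity)]

/-! ### The uniform law: binomial exponential moments -/

/-- **Fixed-location exponential moment under the uniform law on `cell^N`**:
`∫_{cell^N} e^{Λ #{j : |X_j − x|_T < R}} dX ≤ (L³ + (e^Λ − 1)|B_R|)^N` (Tonelli factorisation and the
one-body bound). [folklore] -/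
theorem lintegral_cellN_exp_mul_card_le (N : ℕ) (hL : 0 < L) {Λ R : ℝ} (hΛ : 0 ≤ Λ) (hR : 0 < R)
    (x : Space) :
    ∫⁻ X in cellN N L, ENNReal.ofReal (Real.exp (Λ *
        ((Finset.univ.filter fun j : Fin N => TorusNear L R x (X j)).card : ℝ))) ≤
      ENNReal.ofReal ((L ^ 3 + (Real.exp Λ - 1) * (4 / 3 * Real.pi * R ^ 3)) ^ N) := by
  have hB : 0 ≤ L ^ 3 + (Real.exp Λ - 1) * (4 / 3 * Real.pi * R ^ 3) := by
    have he : 0 ≤ Real.exp Λ - 1 := by linarith [Real.add_one_le_exp Λ]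
    positivity
  simp_rw [ofReal_exp_mul_card_eq_prod]
  rw [lintegral_cellN_prod (fun _ : Fin N => fun y : Space =>
      ENNReal.ofReal (if TorusNear L R x y then Real.exp Λ else 1)) fun _ => measurable_nearWeight L R Λ x,
    Finset.prod_const, Finset.card_univ, Fintype.card_fin, ENNReal.ofReal_pow hB]
  exact pow_le_pow_left₀ (zero_le) (lintegral_cell_nearWeight_le hL hΛ hR x) N

/-- **Tonelli, tagged particle split off first**: `∫_{Ω^{n+1}} F = ∫_Ω ∫_{Ω^n} F(x, Y) dY dx`
(adapted from `lintegral_cellN_succ`, with the opposite order of integration). [folklore] -/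
theorem lintegral_cellN_succ_fst {n : ℕ} (L : ℝ) {F : Config (n + 1) → ℝ≥0∞} (hF : Measurable F) :
    ∫⁻ X in cellN (n + 1) L, F X = ∫⁻ x in cell L, ∫⁻ Y in cellN n L, F (Matrix.vecCons x Y) := by
  set μ : Fin (n + 1) → Measure Space := fun _ => volume.restrict (cell L) with hμ
  have hmp := measurePreserving_piFinSuccAbove μ 0
  have hG : ∀ (x : Space) (Y : Config n),
      (MeasurableEquiv.piFinSuccAbove (fun _ : Fin (n + 1) => Space) 0).symm (x, Y) =
        Matrix.vecCons x Y := by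
    intro x Y
    change Fin.insertNth 0 x Y = (Fin.cons x Y : Config (n + 1))
    exact Fin.insertNth_zero' x Y
  rw [volume_restrict_cellN, volume_restrict_cellN, hmp.symm.lintegral_map_equiv F,
    lintegral_prod
      (fun z => F ((MeasurableEquiv.piFinSuccAbove (fun _ : Fin (n + 1) => Space) 0).symm z))
      (hF.comp (MeasurableEquiv.measurable _)).aemeasurable]
  simp only [hG]
  rfl

/-- The tagged count seen from the split `X = (x, Y)`: the number of bath particles within torus
distance `R` of `x`. [folklore] -/
theorem tagNumber_vecCons (L R : ℝ) (x : Space) (Y : Config m) :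
    tagNumber L R (Matrix.vecCons x Y : Config (m + 1)) =
      (Finset.univ.filter fun i : Fin m => TorusNear L R x (Y i)).card := by
  unfold tagNumber
  have h1 := Finset.add_sum_erase (Finset.univ : Finset (Fin (m + 1)))
    (fun j => if TorusNear L R ((Matrix.vecCons x Y : Config (m + 1)) 0)
      ((Matrix.vecCons x Y : Config (m + 1)) j) then 1 else 0) (Finset.mem_univ 0)
  rw [Fin.sum_univ_succ] at h1
  have h2 := add_left_cancel h1
  rw [Finset.card_filter, Finset.card_filter]
  simp only [Matrix.cons_val_zero, Matrix.cons_val_succ] at h2 ⊢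
  exact h2

/-- The tagged count is a measurable function of the configuration. [folklore] -/
theorem measurable_tagNumber (L R : ℝ) : Measurable fun X : Config (m + 1) => (tagNumber L R X : ℝ) := by
  have h : (fun X : Config (m + 1) => (tagNumber L R X : ℝ)) = fun X =>
      ∑ j ∈ Finset.univ.erase (0 : Fin (m + 1)), if TorusNear L R (X 0) (X j) then (1 : ℝ) else 0 := by
    funext X
    unfold tagNumber
    rw [Finset.natCast_card_filter]
  rw [h]
  refine Finset.measurable_sum _ fun j _ => ?_
  exact Measurable.ite
    (isOpen_setOf_torusNear (continuous_apply 0) (continuous_apply j) L R).measurableSet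
    measurable_const measurable_const

/-- **Tagged exponential moment under the uniform law on `cell^{m+1}`**:
`∫_{cell^{m+1}} e^{Λ #{j ≠ 0 : |X_j − X_0|_T < R}} dX ≤ L³ (L³ + (e^Λ − 1)|B_R|)^m`. [folklore] -/
theorem lintegral_cellN_exp_mul_tagNumber_le (hL : 0 < L) {Λ R : ℝ} (hΛ : 0 ≤ Λ) (hR : 0 < R) :
    ∫⁻ X in cellN (m + 1) L, ENNReal.ofReal (Real.exp (Λ * (tagNumber L R X : ℝ))) ≤
      ENNReal.ofReal ((L ^ 3 + (Real.exp Λ - 1) * (4 / 3 * Real.pi * R ^ 3)) ^ m * L ^ 3) := by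
  have hB : 0 ≤ L ^ 3 + (Real.exp Λ - 1) * (4 / 3 * Real.pi * R ^ 3) := by
    have he : 0 ≤ Real.exp Λ - 1 := by linarith [Real.add_one_le_exp Λ]
    positivity
  have hmeas : Measurable fun X : Config (m + 1) =>
      ENNReal.ofReal (Real.exp (Λ * (tagNumber L R X : ℝ))) :=
    ((measurable_tagNumber L R).const_mul Λ).exp.ennreal_ofReal
  rw [lintegral_cellN_succ_fst L hmeas]
  calc ∫⁻ x in cell L, ∫⁻ Y in cellN m L,
        ENNReal.ofReal (Real.exp (Λ * (tagNumber L R (Matrix.vecCons x Y : Config (m + 1)) : ℝ)))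
      ≤ ∫⁻ _x in cell L,
          ENNReal.ofReal ((L ^ 3 + (Real.exp Λ - 1) * (4 / 3 * Real.pi * R ^ 3)) ^ m) := by
        refine lintegral_mono fun x => ?_
        calc ∫⁻ Y in cellN m L,
              ENNReal.ofReal (Real.exp (Λ * (tagNumber L R (Matrix.vecCons x Y : Config (m + 1)) : ℝ)))
            = ∫⁻ Y in cellN m L, ENNReal.ofReal (Real.exp (Λ *
                ((Finset.univ.filter fun i : Fin m => TorusNear L R x (Y i)).card : ℝ))) :=
              lintegral_congr fun Y => by rw [tagNumber_vecCons]
          _ ≤ _ := lintegral_cellN_exp_mul_card_le m hL hΛ hR x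
    _ = ENNReal.ofReal ((L ^ 3 + (Real.exp Λ - 1) * (4 / 3 * Real.pi * R ^ 3)) ^ m * L ^ 3) := by
        rw [setLIntegral_const, volume_cell, ← ENNReal.ofReal_pow hL.le,
          ← ENNReal.ofReal_mul (pow_nonneg hB m)]

/-! ### Assembly: the free-gas instance of `LocalNumberExpMoments` -/

/-- `(1 + (e^Λ − 1)|B_R|/L³)^k ≤ exp((e^Λ − 1)|B_R| ρ₀)` for `k ≤ ρ₀L³` (binomial ≤ Poisson). [folklore] -/
theorem div_pow_le_exp {L e V ρ₀ : ℝ} {k : ℕ} (hL : 0 < L) (he : 0 ≤ e) (hV : 0 ≤ V)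
    (hk : (k : ℝ) ≤ ρ₀ * L ^ 3) :
    ((L ^ 3 + e * V) / L ^ 3) ^ k ≤ Real.exp (e * V * ρ₀) := by
  have hL3 : 0 < L ^ 3 := by positivity
  have ha : (L ^ 3 + e * V) / L ^ 3 = 1 + e * V / L ^ 3 := by field_simp
  rw [ha]
  calc (1 + e * V / L ^ 3) ^ k ≤ Real.exp (e * V / L ^ 3) ^ k := by
        apply pow_le_pow_left₀ (by positivity)
        linarith [Real.add_one_le_exp (e * V / L ^ 3)]
    _ = Real.exp (k * (e * V / L ^ 3)) := (Real.exp_nat_mul _ k).symm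
    _ ≤ Real.exp (e * V * ρ₀) := by
        apply Real.exp_le_exp.mpr
        calc (k : ℝ) * (e * V / L ^ 3) ≤ ρ₀ * L ^ 3 * (e * V / L ^ 3) :=
              mul_le_mul_of_nonneg_right hk (by positivity)
          _ = e * V * ρ₀ := by field_simp

/-- A constant periodic trial state has `|c|² · (L³)^N = 1`. [folklore] -/
theorem norm_sq_mul_eq_one_of_const (hL : 0 < L) {N : ℕ} (Φ : PeriodicTrialState N L) {c : ℂ}
    (hc : ∀ X, Φ.ψ X = c) : ‖c‖ ^ 2 * (L ^ 3) ^ N = 1 := by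
  have h := Φ.norm_eq
  simp_rw [hc] at h
  rw [setLIntegral_const, volume_cellN, coe_nnnorm_sq_eq_ofReal, ← ENNReal.ofReal_pow hL.le,
    ← ENNReal.ofReal_pow (by positivity), ← ENNReal.ofReal_mul (sq_nonneg _),
    ENNReal.ofReal_eq_one] at h
  exact h

/-- **`LocalNumberExpMoments` at `v = 0` (non-vacuity certificate of `stub_localNumberTail`).**
For the free gas the statement holds verbatim, for every real density bound `ρ₀`, with `N₀ = 0` and
`C = exp((e^Λ − 1)(4π/3)R³ρ₀)`: exact minimisers are constants, the Born law is uniform, the local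
number is binomial with mean `≤ ρ₀|B_R|`, and binomial exponential moments are dominated by Poisson
ones. [folklore] -/
theorem localNumberExpMoments_free (Λ R ρ₀ : ℝ) (hΛ : 0 ≤ Λ) (hR : 0 < R) :
    ∃ C : ℝ, 0 < C ∧ ∀ m : ℕ, ∀ L : ℝ, 0 < L → ((m + 1 : ℕ) : ℝ) ≤ ρ₀ * L ^ 3 →
      ∀ Φ : PeriodicTrialState (m + 1) L,
        periodicEnergy 0 Φ = periodicGroundStateEnergy 0 (m + 1) L →
          (∀ x : Space,
            ∫⁻ X in cellN (m + 1) L,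
                ENNReal.ofReal (‖Φ.ψ X‖ ^ 2 * Real.exp (Λ * (locNumber L R x X : ℝ))) ≤
              ENNReal.ofReal C) ∧
          ∫⁻ X in cellN (m + 1) L,
              ENNReal.ofReal (‖Φ.ψ X‖ ^ 2 * Real.exp (Λ * (tagNumber L R X : ℝ))) ≤
            ENNReal.ofReal C := by
  set e : ℝ := Real.exp Λ - 1 with he_def
  set V : ℝ := 4 / 3 * Real.pi * R ^ 3 with hV_def
  have he : 0 ≤ e := by rw [he_def]; linarith [Real.add_one_le_exp Λ]
  have hV : 0 ≤ V := by rw [hV_def]; positivity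
  refine ⟨Real.exp (e * V * ρ₀), Real.exp_pos _, fun m L hL hdens Φ hE => ?_⟩
  have hL3 : 0 < L ^ 3 := by positivity
  obtain ⟨c, hc⟩ := exists_eq_const_of_free_minimiser hL Φ hE
  have hnorm := norm_sq_mul_eq_one_of_const hL Φ hc
  have hB : 0 ≤ L ^ 3 + e * V := by positivity
  -- pull the constant Born density out of both integrals
  have hpull : ∀ G : Config (m + 1) → ℝ, (∀ X, 0 ≤ G X) →
      ∫⁻ X in cellN (m + 1) L, ENNReal.ofReal (‖Φ.ψ X‖ ^ 2 * G X) =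
        ENNReal.ofReal (‖c‖ ^ 2) * ∫⁻ X in cellN (m + 1) L, ENNReal.ofReal (G X) := by
    intro G hG
    rw [← lintegral_const_mul' _ _ ENNReal.ofReal_ne_top]
    refine lintegral_congr fun X => ?_
    rw [hc, ENNReal.ofReal_mul (sq_nonneg _)]
  constructor
  · intro x
    rw [hpull _ fun X => (Real.exp_pos _).le]
    calc ENNReal.ofReal (‖c‖ ^ 2) *
          ∫⁻ X in cellN (m + 1) L, ENNReal.ofReal (Real.exp (Λ * (locNumber L R x X : ℝ)))
        ≤ ENNReal.ofReal (‖c‖ ^ 2) * ENNReal.ofReal ((L ^ 3 + e * V) ^ (m + 1)) := by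
          gcongr
          exact lintegral_cellN_exp_mul_card_le (m + 1) hL hΛ hR x
      _ = ENNReal.ofReal (((L ^ 3 + e * V) / L ^ 3) ^ (m + 1)) := by
          rw [← ENNReal.ofReal_mul (sq_nonneg _)]
          congr 1
          have h1 : (L ^ 3 + e * V) ^ (m + 1) = (L ^ 3) ^ (m + 1) * ((L ^ 3 + e * V) / L ^ 3) ^ (m + 1) := by
            rw [← mul_pow, mul_div_cancel₀ _ hL3.ne']
          rw [h1, ← mul_assoc, hnorm, one_mul]
      _ ≤ ENNReal.ofReal (Real.exp (e * V * ρ₀)) :=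
          ENNReal.ofReal_le_ofReal (div_pow_le_exp hL he hV hdens)
  · rw [hpull _ fun X => (Real.exp_pos _).le]
    have hm : (m : ℝ) ≤ ρ₀ * L ^ 3 := le_trans (by exact_mod_cast Nat.le_succ m) hdens
    calc ENNReal.ofReal (‖c‖ ^ 2) *
          ∫⁻ X in cellN (m + 1) L, ENNReal.ofReal (Real.exp (Λ * (tagNumber L R X : ℝ)))
        ≤ ENNReal.ofReal (‖c‖ ^ 2) * ENNReal.ofReal ((L ^ 3 + e * V) ^ m * L ^ 3) := by
          gcongr
          exact lintegral_cellN_exp_mul_tagNumber_le hL hΛ hR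
      _ = ENNReal.ofReal (((L ^ 3 + e * V) / L ^ 3) ^ m) := by
          rw [← ENNReal.ofReal_mul (sq_nonneg _)]
          congr 1
          have h1 : (L ^ 3 + e * V) ^ m * L ^ 3 = (L ^ 3) ^ (m + 1) * ((L ^ 3 + e * V) / L ^ 3) ^ m := by
            rw [div_pow, pow_succ (L ^ 3) m]
            field_simp
          rw [h1, ← mul_assoc, hnorm, one_mul]
      _ ≤ ENNReal.ofReal (Real.exp (e * V * ρ₀)) :=
          ENNReal.ofReal_le_ofReal (div_pow_le_exp hL he hV hm)

/-- **The `v = 0` instance of `Goal.stub_localNumberTail`, in the exact shape of the registered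
statement** (the body of `LocalNumberExpMoments` after its two hypotheses on `v`, with `v := 0`):
any `ρ₀ > 0`, `N₀ = 0`. The zero-free hypothesis is not used. [folklore] -/
theorem localNumberExpMoments_instance_zero :
    ∀ Λ R : ℝ, 0 ≤ Λ → 0 < R → ∃ ρ₀ C : ℝ, 0 < ρ₀ ∧ 0 < C ∧ ∃ N₀ : ℕ, ∀ m : ℕ, N₀ ≤ m + 1 →
      ∀ L : ℝ, 0 < L → ((m + 1 : ℕ) : ℝ) ≤ ρ₀ * L ^ 3 →
        ∀ Φ : PeriodicTrialState (m + 1) L,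
          periodicEnergy 0 Φ = periodicGroundStateEnergy 0 (m + 1) L → (∀ X, Φ.ψ X ≠ 0) →
            (∀ x : Space,
              ∫⁻ X in cellN (m + 1) L,
                  ENNReal.ofReal (‖Φ.ψ X‖ ^ 2 * Real.exp (Λ * (locNumber L R x X : ℝ))) ≤
                ENNReal.ofReal C) ∧
            ∫⁻ X in cellN (m + 1) L,
                ENNReal.ofReal (‖Φ.ψ X‖ ^ 2 * Real.exp (Λ * (tagNumber L R X : ℝ))) ≤
              ENNReal.ofReal C := by
  intro Λ R hΛ hR
  obtain ⟨C, hC, h⟩ := localNumberExpMoments_free Λ R 1 hΛ hR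
  exact ⟨1, C, one_pos, hC, 0, fun m _ L hL hdens Φ hE _ => h m L hL hdens Φ hE⟩

end Summit.AtomisticToContinuum.BoseEinsteinCondensation.Cruxes.FibreConductance.TaggedPathHarnack

end
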